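import Summits.ValiantsHypothesis.ValiantsHypothesis.Theses.DivisionGap
import Literature.Computability.AlgebraicComplexity.ArithCircuitProofs
import Literature.Computability.AlgebraicComplexity.PermanentIrreducible
import Literature.Computability.AlgebraicComplexity.MonotoneStructure

/-!
# `DivisionGap.PerDivisionHard` (stmt-ValiantsHypothesis-5065): the variable-counting floor —
where counterexamples CANNOT live (rungs `c = 0, 1` of the crux hold)

Standing-disprover output for the crux `PerDivisionHard`
(`∀ c, ∃ n₀, ∀ n ≥ n₀, ∀ h ≠ 0, 2 ^ ((Nat.log 2 n + c) ^ c) < L(per_n · h) + L(h)` over `ℝ≥0`).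
A counterexample search must respect the following floor, valid for EVERY nonzero `h`:

* `card_vars_le_of_computes` / `card_vars_le_complexity` — a fan-in-two circuit of size `s` mentions
  at most `2s + 1` variables, so `#vars(f) ≤ 2·L(f) + 1` (any commutative semiring; gate-by-gate
  bookkeeping on the tree's `ArithCircuit` fold semantics, the variable sets produced existentially so
  that no auxiliary definition is introduced).
* `vars_perPoly_mul` — over `ℝ≥0` nothing cancels, so every variable `x_ij` occurs in `per_n · h`
  for every `h ≠ 0` (the permutation monomial of the transposition `(i j)` times any monomial of `h`).
* `sq_le_of_pair` — hence `n² ≤ 2·L(per_n · h) + 1` for all `h ≠ 0`.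
* `perDivisionHard_rung_zero`, `perDivisionHard_rung_one` — consequently the instances `c = 0`
  (threshold `2`, from `n = 3`) and `c = 1` (threshold `2^{⌊log₂ n⌋ + 1} ≤ 2n`, from `n = 5`) of the
  crux's matrix hold: no counterexample exists below `c = 2`, where the required bound becomes
  `n^{log₂ n + 4}·16`, beyond every known method for arbitrary monotone multiples
  (Hrubeš–Yehudayoff 2021 §6, Problem 2).

None of these asserts the crux; they bound the region a refutation would have to come from.
-/

noncomputable section

namespace Summit.ValiantsHypothesis.Theorems.PerDivisionHardNegative

open Literature.Computability.AlgebraicComplexity MvPolynomial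
open scoped NNReal

namespace VarsCount

open ArithCircuit

variable {k : Type} [CommSemiring k] {σ : Type} [DecidableEq σ]

/-! ### Semantics: a circuit computes a polynomial in few variables (no auxiliary definitions:
the set of "mentioned variables" is produced existentially, gate by gate) -/

/-- The variables of a list sum. [folklore] -/
theorem vars_list_sum_subset (L : List (MvPolynomial σ k)) (W : Finset σ)
    (h : ∀ p ∈ L, p.vars ⊆ W) : L.sum.vars ⊆ W := by
  induction L with
  | nil => simp
  | cons p L ih =>
    rw [List.sum_cons]
    refine (vars_add_subset _ _).trans (Finset.union_subset (h p (by simp)) ?_)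
    exact ih fun q hq => h q (by simp [hq])

/-- The variables of a list product. [folklore] -/
theorem vars_list_prod_subset (L : List (MvPolynomial σ k)) (W : Finset σ)
    (h : ∀ p ∈ L, p.vars ⊆ W) : L.prod.vars ⊆ W := by
  induction L with
  | nil => rw [List.prod_nil, ← C_1, vars_C]; exact Finset.empty_subset _
  | cons p L ih =>
    rw [List.prod_cons]
    refine (vars_mul _ _).trans (Finset.union_subset (h p (by simp)) ?_)
    exact ih fun q hq => h q (by simp [hq])

/-- Scalar multiples do not add variables. [folklore] -/
theorem vars_smul_subset' (a : k) (p : MvPolynomial σ k) : (a • p).vars ⊆ p.vars := by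
  rw [smul_eq_C_mul]
  refine (vars_mul _ _).trans ?_
  simp [vars_C]

/-- A variable is a polynomial in itself. [folklore] -/
theorem vars_X_subset_singleton (i : σ) : (X i : MvPolynomial σ k).vars ⊆ {i} := by
  intro v hv
  rw [vars_def, Multiset.mem_toFinset] at hv
  simpa using Multiset.mem_of_le (degrees_X' i) hv

/-- An operand evaluates to a polynomial in at most ONE variable beyond those of the values it may
read. [folklore] -/
theorem exists_vars_operand_eval (vals : List (MvPolynomial σ k)) (W : Finset σ)
    (hvals : ∀ w ∈ vals, w.vars ⊆ W) (u : Operand k σ) :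
    ∃ S : Finset σ, S.card ≤ 1 ∧ (u.eval vals).vars ⊆ S ∪ W := by
  cases u with
  | var i =>
    refine ⟨{i}, by simp, ?_⟩
    simp only [Operand.eval]
    exact (vars_X_subset_singleton i).trans Finset.subset_union_left
  | const c => exact ⟨∅, by simp, by simp [Operand.eval, vars_C]⟩
  | gate j =>
    refine ⟨∅, by simp, ?_⟩
    simp only [Operand.eval, Finset.empty_union, List.getD_eq_getElem?_getD]
    cases hj : vals[j]? with
    | none => simp
    | some w =>
      simp only [Option.getD_some]
      exact hvals w (List.mem_of_getElem? hj)

/-- A list of operands evaluates within at most `length` variables beyond those of the values.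
[folklore] -/
theorem exists_vars_operands_eval (vals : List (MvPolynomial σ k)) (W : Finset σ)
    (hvals : ∀ w ∈ vals, w.vars ⊆ W) (us : List (Operand k σ)) :
    ∃ S : Finset σ, S.card ≤ us.length ∧ ∀ u ∈ us, (u.eval vals).vars ⊆ S ∪ W := by
  induction us with
  | nil => exact ⟨∅, by simp, by simp⟩
  | cons u us ih =>
    obtain ⟨S₁, hS₁, hu⟩ := exists_vars_operand_eval vals W hvals u
    obtain ⟨S₂, hS₂, hus⟩ := ih
    refine ⟨S₁ ∪ S₂, ?_, ?_⟩
    · calc (S₁ ∪ S₂).card ≤ S₁.card + S₂.card := Finset.card_union_le _ _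
        _ ≤ (u :: us).length := by simp; omega
    · intro u' hu'
      rcases List.mem_cons.1 hu' with rfl | h'
      · exact hu.trans (Finset.union_subset_union Finset.subset_union_left le_rfl)
      · exact (hus u' h').trans (Finset.union_subset_union Finset.subset_union_right le_rfl)

/-- A gate evaluates within at most `fanIn` variables beyond those of the earlier values.
[folklore] -/
theorem exists_vars_gate_eval (vals : List (MvPolynomial σ k)) (W : Finset σ)
    (hvals : ∀ w ∈ vals, w.vars ⊆ W) (g : Gate k σ) :
    ∃ S : Finset σ, S.card ≤ g.fanIn ∧ (g.eval vals).vars ⊆ S ∪ W := by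
  obtain ⟨S, hS, hops⟩ := exists_vars_operands_eval vals W hvals g.args
  refine ⟨S, hS, ?_⟩
  cases g with
  | sum args =>
    simp only [Gate.eval]
    refine vars_list_sum_subset _ _ fun p hp => ?_
    obtain ⟨a, ha, rfl⟩ := List.mem_map.1 hp
    refine (vars_smul_subset' _ _).trans (hops a.2 ?_)
    simp only [Gate.args]
    exact List.mem_map.2 ⟨a, ha, rfl⟩
  | prod args =>
    simp only [Gate.eval]
    refine vars_list_prod_subset _ _ fun p hp => ?_
    obtain ⟨u, hu, rfl⟩ := List.mem_map.1 hp
    exact hops u hu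

/-- The values of a list of fan-in-two gates live in at most `2 · length` variables. [folklore] -/
theorem exists_vars_gateValues (gs : List (Gate k σ)) (h2 : ∀ g ∈ gs, g.fanIn ≤ 2) :
    ∃ W : Finset σ, W.card ≤ 2 * gs.length ∧ ∀ w ∈ gateValues gs, w.vars ⊆ W := by
  induction gs using List.reverseRecOn with
  | nil => exact ⟨∅, by simp, by simp [gateValues]⟩
  | append_singleton gs g ih =>
    obtain ⟨W, hW, hvals⟩ := ih fun g' hg' => h2 g' (List.mem_append_left _ hg')
    obtain ⟨S, hS, hg⟩ := exists_vars_gate_eval (gateValues gs) W hvals g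
    have hfan : g.fanIn ≤ 2 := h2 g (by simp)
    refine ⟨W ∪ S, ?_, ?_⟩
    · calc (W ∪ S).card ≤ W.card + S.card := Finset.card_union_le _ _
        _ ≤ 2 * (gs ++ [g]).length := by simp; omega
    · intro w hw
      rw [gateValues_append_singleton, List.mem_append, List.mem_singleton] at hw
      rcases hw with hw | rfl
      · exact (hvals w hw).trans Finset.subset_union_left
      · rw [Finset.union_comm]; exact hg

end VarsCount

open VarsCount

section General

variable {k : Type} [CommSemiring k] {σ : Type} [DecidableEq σ]

/-- **Variable-counting floor.** A fan-in-two circuit of size `s` computing `f` forces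
`#vars(f) ≤ 2s + 1`. [folklore] -/
theorem card_vars_le_of_computes {P : ArithCircuit k σ} {f : MvPolynomial σ k}
    (h2 : P.IsFanInTwo) (hf : P.Computes f) : f.vars.card ≤ 2 * P.size + 1 := by
  obtain ⟨W, hW, hvals⟩ := exists_vars_gateValues P.gates h2
  obtain ⟨S, hS, hout⟩ := exists_vars_operand_eval (ArithCircuit.gateValues P.gates) W hvals P.output
  have hsub : f.vars ⊆ S ∪ W := by
    rw [← show P.eval = f from hf]
    exact hout
  calc f.vars.card ≤ (S ∪ W).card := Finset.card_le_card hsub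
    _ ≤ S.card + W.card := Finset.card_union_le _ _
    _ ≤ 2 * P.size + 1 := by unfold ArithCircuit.size; omega

/-- **`#vars(f) ≤ 2·L(f) + 1`** for the tree's fan-in-two `complexity`. [folklore] -/
theorem card_vars_le_complexity (f : MvPolynomial σ k) : f.vars.card ≤ 2 * complexity f + 1 := by
  obtain ⟨P, h2, hf, hs⟩ := ArithCircuit.exists_computes_size_eq_complexity f
  rw [← hs]
  exact card_vars_le_of_computes h2 hf

end General

/-! ### The permanent: every variable survives in every monotone multiple -/

section Permanent

variable {n : ℕ}

/-- Over `ℝ≥0`, every variable `x_ij` occurs in `per_n · h` for every nonzero `h`: the monomial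
of the transposition `(i j)` has `x_ij`-degree one and nothing cancels. [folklore] -/
theorem vars_perPoly_mul {h : MvPolynomial (Fin n × Fin n) ℝ≥0} (hh : h ≠ 0) :
    (perPoly (Fin n) ℝ≥0 * h).vars = Finset.univ := by
  classical
  refine Finset.eq_univ_iff_forall.2 fun v => ?_
  obtain ⟨i, j⟩ := v
  obtain ⟨m₀, hm₀⟩ := MvPolynomial.support_nonempty.2 hh
  set ρ : Equiv.Perm (Fin n) := Equiv.swap i j with hρ
  have hper : permMonomial ρ ∈ (perPoly (Fin n) ℝ≥0).support := by
    rw [mem_support_iff, coeff_permMonomial_perPoly]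
    exact one_ne_zero
  have hmem := add_mem_support_mul hper hm₀
  rw [mem_vars_iff_mem_support]
  refine ⟨permMonomial ρ + m₀, hmem, ?_⟩
  rw [Finsupp.mem_support_iff, Finsupp.add_apply, permMonomial_apply]
  have : ρ j = i := by rw [hρ]; exact Equiv.swap_apply_right i j
  rw [if_pos this]
  omega

/-- **The floor for the crux's pairs:** `n² ≤ 2·L(per_n · h) + 1` for every nonzero `h` over `ℝ≥0`.
[folklore] -/
theorem sq_le_of_pair {h : MvPolynomial (Fin n × Fin n) ℝ≥0} (hh : h ≠ 0) :
    n * n ≤ 2 * complexity (perPoly (Fin n) ℝ≥0 * h) + 1 := by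
  classical
  have hc := card_vars_le_complexity (perPoly (Fin n) ℝ≥0 * h)
  rw [vars_perPoly_mul hh, Finset.card_univ, Fintype.card_prod, Fintype.card_fin] at hc
  exact hc

/-- **Rung `c = 0` of the crux holds** (threshold `2^{(log n + 0)^0} = 2`; from `n = 3`): no
counterexample to `PerDivisionHard` has `c = 0`. [folklore] -/
theorem perDivisionHard_rung_zero :
    ∃ n₀ : ℕ, ∀ n ≥ n₀, ∀ h : MvPolynomial (Fin n × Fin n) ℝ≥0, h ≠ 0 →
      2 ^ ((Nat.log 2 n + 0) ^ 0) < complexity (perPoly (Fin n) ℝ≥0 * h) + complexity h := by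
  refine ⟨3, fun n hn h hh => ?_⟩
  have hsq := sq_le_of_pair hh
  have h9 : 3 * 3 ≤ n * n := Nat.mul_le_mul hn hn
  rw [pow_zero, pow_one]
  omega

/-- **Rung `c = 1` of the crux holds** (threshold `2^{⌊log₂ n⌋ + 1} ≤ 2n`; from `n = 5`): no
counterexample to `PerDivisionHard` has `c ≤ 1`. [folklore] -/
theorem perDivisionHard_rung_one :
    ∃ n₀ : ℕ, ∀ n ≥ n₀, ∀ h : MvPolynomial (Fin n × Fin n) ℝ≥0, h ≠ 0 →
      2 ^ ((Nat.log 2 n + 1) ^ 1) < complexity (perPoly (Fin n) ℝ≥0 * h) + complexity h := by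
  refine ⟨5, fun n hn h hh => ?_⟩
  have hsq := sq_le_of_pair hh
  have h25 : 5 * n ≤ n * n := Nat.mul_le_mul_right n hn
  have hlog : 2 ^ Nat.log 2 n ≤ n := Nat.pow_log_le_self 2 (by omega)
  rw [pow_one, pow_succ]
  omega

end Permanent

end Summit.ValiantsHypothesis.Theorems.PerDivisionHardNegative

end
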